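import Summits.AtomisticToContinuum.FouriersLaw.Theses.HeatModeWeylLaw

/-!
# `SineModeBasics` — the sine energy mode is in `L²` of the Gibbs measure with positive variance

Closes item `stmt-AtomisticToContinuum-12397`, the support decl `SineModeBasics` of the route
`Summits/AtomisticToContinuum/FouriersLaw/Theses/HeatModeWeylLaw`: for `pinnedChain ω₂ lam β γ` (all four
parameters positive), `T > 0` and `N ≥ 1`, the Dirichlet sine energy mode
`E_N(q,p) = ∑_i sin(π(i+½)/N)·(p_i²/2 + U(q_i))
            + ∑_{j=i+1} ½(sin(π(i+½)/N) + sin(π(j+½)/N))·V(q_j−q_i)`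
satisfies `E_N ∈ L²(μ_{N,T})` for the Gibbs measure `μ_{N,T} = Z⁻¹ e^{-H/T} dq dp` and has positive
Gibbs variance `∫ (E_N − ∫ E_N dμ)² dμ > 0`.

Proof. (1) `|E_N| ≤ H_N` termwise (`|sin| ≤ 1`, `U, V ≥ 0`), and `H_N ∈ L²(μ)` because
`H² ≤ 8T² e^{H/(2T)}` and `e^{ϑH} ∈ L¹(μ)` for `ϑ < 1/T`
(`pinnedChain_integrable_exp_mul_hamiltonian_gibbsMeasure`, Cuneo–Eckmann–Hairer–Rey-Bellet 2018
Thm 2.13(2), equilibrium case). (2) A continuous `L²` observable that is not constant has positive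
variance under `μ`: the set `{E_N ≠ ∫ E_N dμ}` is open and nonempty, Lebesgue measure charges it, and
Lebesgue measure is absolutely continuous with respect to the tilted measure `μ`
(`absolutelyContinuous_tilted`); `E_N` is not constant since `E_N(0,0) = 0` while
`E_N(0, p ≡ 2) = 2∑_i sin(π(i+½)/N) > 0` (`0 < π(i+½)/N < π` for `i < N`).
-/

namespace Summit.AtomisticToContinuum.FouriersLaw.Theorems

open MeasureTheory
open Literature.MathematicalPhysics.KineticTheory.HeatConduction
open Literature.MathematicalPhysics.KineticTheory

/-- A continuous observable dominated by the Hamiltonian, `|g| ≤ H_N`, is square integrable for the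
Gibbs measure of the pinned chain at temperature `T > 0` (`H² ≤ 8T² e^{H/(2T)}` and
`e^{H/(2T)} ∈ L¹(μ_T)`). [folklore] -/
theorem sineModeBasics_memLp_two_of_abs_le_hamiltonian {N : ℕ} {ω₂ lam β : ℝ} (hω : 0 < ω₂)
    (hl : 0 ≤ lam) (hβ : 0 ≤ β) (γ : ℝ) {T : ℝ} (hT : 0 < T) {g : PhaseSpace N → ℝ}
    (hg : Continuous g) (hgH : ∀ x, |g x| ≤ (pinnedChain ω₂ lam β γ).hamiltonian N x) :
    MemLp g 2 ((pinnedChain ω₂ lam β γ).gibbsMeasure N T) := by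
  have hϑ : 1 / (2 * T) < 1 / T := one_div_lt_one_div_of_lt hT (by linarith)
  have hexp := pinnedChain_integrable_exp_mul_hamiltonian_gibbsMeasure hω hl hβ γ N hT hϑ
  have hH0 : ∀ x, 0 ≤ (pinnedChain ω₂ lam β γ).hamiltonian N x :=
    fun x => pinnedChain_hamiltonian_nonneg hω.le hl hβ γ N x
  have hHc : Continuous ((pinnedChain ω₂ lam β γ).hamiltonian N) :=
    pinnedChain_continuous_hamiltonian ω₂ lam β γ N
  have key : ∀ x, (pinnedChain ω₂ lam β γ).hamiltonian N x ^ 2 ≤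
      8 * T ^ 2 * Real.exp (1 / (2 * T) * (pinnedChain ω₂ lam β γ).hamiltonian N x) := by
    intro x
    have hy : 0 ≤ 1 / (2 * T) * (pinnedChain ω₂ lam β γ).hamiltonian N x :=
      mul_nonneg (by positivity) (hH0 x)
    have h := Real.pow_div_factorial_le_exp (1 / (2 * T) * (pinnedChain ω₂ lam β γ).hamiltonian N x)
      hy 2
    simp only [Nat.factorial_two, Nat.cast_ofNat] at h
    have e : (1 / (2 * T) * (pinnedChain ω₂ lam β γ).hamiltonian N x) ^ 2 / 2 =
        (pinnedChain ω₂ lam β γ).hamiltonian N x ^ 2 / (8 * T ^ 2) := by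
      field_simp
      ring
    rw [e, div_le_iff₀ (by positivity)] at h
    linarith
  have hH2 : Integrable (fun x => (pinnedChain ω₂ lam β γ).hamiltonian N x ^ 2)
      ((pinnedChain ω₂ lam β γ).gibbsMeasure N T) := by
    refine (hexp.const_mul (8 * T ^ 2)).mono' (by fun_prop) (ae_of_all _ fun x => ?_)
    rw [Real.norm_eq_abs, abs_of_nonneg (sq_nonneg _)]
    exact key x
  have hHmem : MemLp ((pinnedChain ω₂ lam β γ).hamiltonian N) 2
      ((pinnedChain ω₂ lam β γ).gibbsMeasure N T) :=
    (memLp_two_iff_integrable_sq hHc.aestronglyMeasurable).mpr hH2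
  refine hHmem.of_le hg.aestronglyMeasurable (ae_of_all _ fun x => ?_)
  rw [Real.norm_eq_abs, Real.norm_eq_abs, abs_of_nonneg (hH0 x)]
  exact hgH x

/-- A continuous square-integrable observable that is not constant has positive variance under the
Gibbs measure of the pinned chain (`T > 0`): the open nonempty set `{g ≠ ∫ g dμ}` has positive
Lebesgue measure and Lebesgue measure is absolutely continuous with respect to
`μ_T = Z⁻¹e^{-H/T}dqdp`. [folklore] -/
theorem sineModeBasics_variance_pos {N : ℕ} {ω₂ lam β : ℝ} (hω : 0 < ω₂) (hl : 0 ≤ lam)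
    (hβ : 0 ≤ β) (γ : ℝ) {T : ℝ} (hT : 0 < T) {g : PhaseSpace N → ℝ} (hg : Continuous g)
    (hg2 : MemLp g 2 ((pinnedChain ω₂ lam β γ).gibbsMeasure N T)) (hab : ∃ a b, g a ≠ g b) :
    0 < ∫ x, (g x - ∫ y, g y ∂((pinnedChain ω₂ lam β γ).gibbsMeasure N T)) ^ 2
      ∂((pinnedChain ω₂ lam β γ).gibbsMeasure N T) := by
  haveI : IsProbabilityMeasure ((pinnedChain ω₂ lam β γ).gibbsMeasure N T) :=
    pinnedChain_isProbabilityMeasure_gibbsMeasure hω hl hβ γ N hT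
  have hf2 : MemLp (fun x => g x - ∫ y, g y ∂((pinnedChain ω₂ lam β γ).gibbsMeasure N T)) 2
      ((pinnedChain ω₂ lam β γ).gibbsMeasure N T) := hg2.sub (memLp_const _)
  rw [integral_pos_iff_support_of_nonneg (fun x => sq_nonneg _) hf2.integrable_sq]
  have hsupp : Function.support
      (fun x => (g x - ∫ y, g y ∂((pinnedChain ω₂ lam β γ).gibbsMeasure N T)) ^ 2) =
      {x | g x ≠ ∫ y, g y ∂((pinnedChain ω₂ lam β γ).gibbsMeasure N T)} := by
    ext x
    simp [sub_eq_zero]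
  rw [hsupp]
  have hopen : IsOpen {x | g x ≠ ∫ y, g y ∂((pinnedChain ω₂ lam β γ).gibbsMeasure N T)} :=
    isOpen_ne_fun hg continuous_const
  have hne : {x | g x ≠ ∫ y, g y ∂((pinnedChain ω₂ lam β γ).gibbsMeasure N T)}.Nonempty := by
    obtain ⟨a, b, hab⟩ := hab
    by_cases ha : g a = ∫ y, g y ∂((pinnedChain ω₂ lam β γ).gibbsMeasure N T)
    · exact ⟨b, fun hb => hab (ha.trans hb.symm)⟩
    · exact ⟨a, ha⟩
  have hvol := hopen.measure_pos (volume : Measure (PhaseSpace N)) hne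
  have hac : (volume : Measure (PhaseSpace N)) ≪ (pinnedChain ω₂ lam β γ).gibbsMeasure N T :=
    absolutelyContinuous_tilted (pinnedChain_integrable_gibbsDensity hω hl hβ γ N hT)
  exact pos_iff_ne_zero.mpr fun h0 => hvol.ne' (hac h0)

/-- The sine weights of the Dirichlet mode are positive: `0 < sin(π(i+½)/N)` for `i < N`. [folklore] -/
theorem sineModeBasics_weight_pos {N : ℕ} (hN : 1 ≤ N) (i : Fin N) :
    0 < Real.sin (Real.pi * ((i : ℝ) + 1 / 2) / N) := by
  have hN' : (0 : ℝ) < N := Nat.cast_pos.mpr (by omega)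
  have hi : ((i : ℕ) : ℝ) + 1 ≤ (N : ℝ) := by exact_mod_cast Nat.succ_le_of_lt i.isLt
  refine Real.sin_pos_of_pos_of_lt_pi (by positivity) ?_
  rw [div_lt_iff₀ hN']
  exact mul_lt_mul_of_pos_left (by linarith) Real.pi_pos

/-- Square integrability and positive variance together, for a continuous non-constant observable
dominated by the Hamiltonian. [folklore] -/
theorem sineModeBasics_memLp_and_variance_pos {N : ℕ} {ω₂ lam β : ℝ} (hω : 0 < ω₂) (hl : 0 ≤ lam)
    (hβ : 0 ≤ β) (γ : ℝ) {T : ℝ} (hT : 0 < T) (g : PhaseSpace N → ℝ) (hg : Continuous g)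
    (hgH : ∀ x, |g x| ≤ (pinnedChain ω₂ lam β γ).hamiltonian N x) (hab : ∃ a b, g a ≠ g b) :
    MemLp g 2 ((pinnedChain ω₂ lam β γ).gibbsMeasure N T) ∧
      0 < ∫ x, (g x - ∫ y, g y ∂((pinnedChain ω₂ lam β γ).gibbsMeasure N T)) ^ 2
        ∂((pinnedChain ω₂ lam β γ).gibbsMeasure N T) :=
  have h2 := sineModeBasics_memLp_two_of_abs_le_hamiltonian hω hl hβ γ hT hg hgH
  ⟨h2, sineModeBasics_variance_pos hω hl hβ γ hT hg h2 hab⟩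

/-- **SineModeBasics.** For `pinnedChain ω₂ lam β γ` (`ω₂, lam, β, γ > 0`), `T > 0` and `N ≥ 1` the
sine energy mode `E_N` is in `L²` of the Gibbs measure `μ_{N,T}` and has positive Gibbs variance.
[cite: CuneoEckmannHairerReyBellet2018, Thm 2.13(2) and §3.1] -/
theorem sineModeBasics_proof :
    Summit.AtomisticToContinuum.FouriersLaw.Theses.HeatModeWeylLaw.SineModeBasics := by
  intro ω₂ lam β γ hω hl hβ hγ T hT
  dsimp only
  intro N hN
  have hUc : Continuous (pinnedChain ω₂ lam β γ).U :=
    (pinnedChain_contDiff_U ω₂ lam β γ (n := 0)).continuous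
  have hVc : Continuous (pinnedChain ω₂ lam β γ).V :=
    (pinnedChain_contDiff_V ω₂ lam β γ (n := 0)).continuous
  have hU0 : ∀ q, 0 ≤ (pinnedChain ω₂ lam β γ).U q := fun q => by
    show 0 ≤ ω₂ * q ^ 2 / 2 + lam * q ^ 4 / 4
    positivity
  have hV0 : ∀ r, 0 ≤ (pinnedChain ω₂ lam β γ).V r := fun r => by
    show 0 ≤ r ^ 2 / 2 + β * r ^ 4 / 4
    positivity
  have hw : ∀ i : Fin N, 0 < Real.sin (Real.pi * ((i : ℝ) + 1 / 2) / N) :=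
    fun i => sineModeBasics_weight_pos hN i
  refine sineModeBasics_memLp_and_variance_pos hω hl.le hβ.le γ hT _ ?_ ?_ ?_
  · -- continuity
    refine Continuous.add (continuous_finsetSum _ fun i _ => by fun_prop)
      (continuous_finsetSum _ fun i _ => continuous_finsetSum _ fun j _ => ?_)
    split_ifs
    · fun_prop
    · exact continuous_const
  · -- domination by the Hamiltonian
    intro x
    unfold OscillatorChain.hamiltonian
    refine (abs_add_le _ _).trans (add_le_add ?_ ?_)
    · refine (Finset.abs_sum_le_sum_abs _ _).trans (Finset.sum_le_sum fun i _ => ?_)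
      have ht : 0 ≤ x.2 i ^ 2 / 2 + (pinnedChain ω₂ lam β γ).U (x.1 i) :=
        add_nonneg (by positivity) (hU0 _)
      rw [abs_mul, abs_of_nonneg ht]
      calc |Real.sin (Real.pi * ((i : ℝ) + 1 / 2) / N)| *
            (x.2 i ^ 2 / 2 + (pinnedChain ω₂ lam β γ).U (x.1 i))
          ≤ 1 * (x.2 i ^ 2 / 2 + (pinnedChain ω₂ lam β γ).U (x.1 i)) :=
            mul_le_mul_of_nonneg_right (Real.abs_sin_le_one _) ht
        _ = x.2 i ^ 2 / 2 + (pinnedChain ω₂ lam β γ).U (x.1 i) := one_mul _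
    · refine (Finset.abs_sum_le_sum_abs _ _).trans (Finset.sum_le_sum fun i _ =>
        (Finset.abs_sum_le_sum_abs _ _).trans (Finset.sum_le_sum fun j _ => ?_))
      split_ifs with hij
      · rw [abs_mul, abs_of_nonneg (hV0 _)]
        have hs : |(Real.sin (Real.pi * ((i : ℝ) + 1 / 2) / N) +
            Real.sin (Real.pi * ((j : ℝ) + 1 / 2) / N)) / 2| ≤ 1 := by
          rw [abs_div, abs_two, div_le_one (by norm_num : (0 : ℝ) < 2)]
          have h1 := Real.abs_sin_le_one (Real.pi * ((i : ℝ) + 1 / 2) / N)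
          have h2 := Real.abs_sin_le_one (Real.pi * ((j : ℝ) + 1 / 2) / N)
          exact (abs_add_le _ _).trans (by linarith)
        calc |(Real.sin (Real.pi * ((i : ℝ) + 1 / 2) / N) +
              Real.sin (Real.pi * ((j : ℝ) + 1 / 2) / N)) / 2| *
              (pinnedChain ω₂ lam β γ).V (x.1 j - x.1 i)
            ≤ 1 * (pinnedChain ω₂ lam β γ).V (x.1 j - x.1 i) :=
              mul_le_mul_of_nonneg_right hs (hV0 _)
          _ = (pinnedChain ω₂ lam β γ).V (x.1 j - x.1 i) := one_mul _
      · simp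
  · -- not constant: `E_N(0) = 0 < E_N(0, p ≡ 2)`
    refine ⟨0, ((fun _ => 0), (fun _ => 2)), ne_of_lt ?_⟩
    have hU00 : (pinnedChain ω₂ lam β γ).U 0 = 0 := by
      show ω₂ * (0 : ℝ) ^ 2 / 2 + lam * (0 : ℝ) ^ 4 / 4 = 0
      norm_num
    have hV00 : (pinnedChain ω₂ lam β γ).V 0 = 0 := by
      show (0 : ℝ) ^ 2 / 2 + β * (0 : ℝ) ^ 4 / 4 = 0
      norm_num
    haveI : Nonempty (Fin N) := ⟨⟨0, by omega⟩⟩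
    norm_num [hU00, hV00]
    exact Finset.sum_pos (fun i _ => mul_pos (hw i) (by norm_num)) Finset.univ_nonempty

end Summit.AtomisticToContinuum.FouriersLaw.Theorems
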